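import Summits.CriticalPhenomena.PercolationContinuityZ3.Theorems.PercNearOneGluingAdditiveGluingTBlockExpansion
import Summits.CriticalPhenomena.PercolationContinuityZ3.Theorems.PercNearOneGluingAdditiveGluingGluingLemma5
import Summits.CriticalPhenomena.PercolationContinuityZ3.Theorems.PercNearOneGluingAdditiveGluingWholeBlockKernel
import HarnessLib

/-! # Crux `PercNearOneGluing.AdditiveGluing` (stmt-CriticalPhenomena-4576) — the one-level T-form CERTIFICATE for a glued block at its
# Question-9 designation (seat (b) V⁺-form, depth prover `png-dp-vplus`)

Support file (`--supports stmt-CriticalPhenomena-4576`); no definitions, no named facts.  Companion of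
`…AdditiveGluingTBlockExpansion.lean` (the exact expansion `T_d^{u/S}(S) = Σ_N μ_{u/S}(L_N)·T_d^{q_N}(N)`).

`μ_{u/S}` = bond percolation on `Fin n` with the block `S` glued, relays `A ∋ b`, `Disjoint S A`; `q_N` = `u` with every star of `S` killed
and `N` glued, `q_∅` = the star-killed weighting; `T_d^{p}(X) := μ_p(X ↮ A) + μ_p(X ↔ b) − μ_p(d ↔ b)`.

* `T_block_dropRelayLayers`: if `e ∈ A` minimises `μ_{q_∅}(· ↔ b)` over `A` (Kozma–Nitzan's **Question-9 designation** of the block: the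
  minimiser in the graph with the block's stars deleted), then every layer `N` meeting `A` contributes `≥ 0` (gluing Lemma 5,
  `stub_gluingLemma5`, or `b ∈ N`), so
  `T_e^{u/S}(S) ≥ Σ_{N : Disjoint N A} μ_{u/S}(L_N) · T_e^{q_N}(N)`.
* `T_layer_empty`: the empty layer's bracket is `1 − μ_{q_∅}(e ↔ b) ≥ 0` (the ISOLATED-CORNER GAIN of the T-form).
* `T_block_certificate`: the two combined — `T_e^{u/S}(S) ≥ μ_{u/S}(L_∅)(1 − μ_{q_∅}(e ↔ b)) + Σ_{N ≠ ∅, Disjoint N A} μ_{u/S}(L_N) T_e^{q_N}(N)`: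
  one level of seat (b)'s V⁺ / V_{Q9} recursion (memo TFormCalculus-b: relay leaves by GL5, iso leaf exact, relay-free blocks recurse).
The class theorems (no free neighbour / one free neighbour: Kozma–Nitzan Thms 4–5 for blocks in the crux's additive form) are in the
companion `…AdditiveGluingTBlockClasses.lean`.
[cite: KozmaNitzan2024, §3.2 (Lemma 5 p. 13, Thms 4–5 pp. 12–14), Question 9 (p. 36)]
-/

namespace Summit.CriticalPhenomena.PercolationContinuityZ3.Theorems

open MeasureTheory Set
open Literature.Probability.LatticeModels (prodBernoulli)
open Literature.Probability.Percolation (BondConfig openConn openGraph)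
open scoped BigOperators Classical

noncomputable section

section TBlockCertificate

variable {n : ℕ}

/-- **A layer meeting the relay set contributes non-negatively at the Question-9 designation.**  If `e` minimises `μ_{q_∅}(· ↔ b)` over
`A` and `N ∩ A ≠ ∅`, then `μ_{q_N}(N ↔ b) ≥ μ_{q_N}(e ↔ b)` (gluing Lemma 5 with `v ∈ N ∩ A`, or trivially if `b ∈ N`), hence the layer
bracket `μ_{q_N}(N ↮ A) + μ_{q_N}(N ↔ b) − μ_{q_N}(e ↔ b) ≥ 0`. [cite: KozmaNitzan2024, Lemma 5 (p. 13)] -/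
theorem T_layer_relay_nonneg (u : Sym2 (Fin n) → unitInterval) (A S N : Finset (Fin n)) (e b : Fin n)
    (hmin : ∀ a ∈ A,
      (prodBernoulli (fun e' : Sym2 (Fin n) => if (∃ y ∈ e', y ∈ S) then (0 : unitInterval) else u e')).real (openConn e b) ≤
        (prodBernoulli (fun e' : Sym2 (Fin n) => if (∃ y ∈ e', y ∈ S) then (0 : unitInterval) else u e')).real (openConn a b))
    (hNA : ¬ Disjoint N A) :
    0 ≤ (prodBernoulli (fun e' : Sym2 (Fin n) =>
            if (∀ y ∈ e', y ∈ N) ∧ ¬ e'.IsDiag then 1 else if (∃ y ∈ e', y ∈ S) then 0 else u e')).real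
          (⋃ v ∈ N, ⋃ a ∈ A, openConn v a)ᶜ +
        (prodBernoulli (fun e' : Sym2 (Fin n) =>
            if (∀ y ∈ e', y ∈ N) ∧ ¬ e'.IsDiag then 1 else if (∃ y ∈ e', y ∈ S) then 0 else u e')).real
          (⋃ v ∈ N, openConn v b) -
        (prodBernoulli (fun e' : Sym2 (Fin n) =>
            if (∀ y ∈ e', y ∈ N) ∧ ¬ e'.IsDiag then 1 else if (∃ y ∈ e', y ∈ S) then 0 else u e')).real
          (openConn e b) := by
  obtain ⟨v, hvN, hvA⟩ := Finset.not_disjoint_iff.1 hNA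
  have h0 : 0 ≤ (prodBernoulli (fun e' : Sym2 (Fin n) =>
            if (∀ y ∈ e', y ∈ N) ∧ ¬ e'.IsDiag then 1 else if (∃ y ∈ e', y ∈ S) then 0 else u e')).real
          (⋃ v ∈ N, ⋃ a ∈ A, openConn v a)ᶜ := measureReal_nonneg
  have hle : (prodBernoulli (fun e' : Sym2 (Fin n) =>
            if (∀ y ∈ e', y ∈ N) ∧ ¬ e'.IsDiag then 1 else if (∃ y ∈ e', y ∈ S) then 0 else u e')).real
          (openConn e b) ≤
      (prodBernoulli (fun e' : Sym2 (Fin n) =>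
            if (∀ y ∈ e', y ∈ N) ∧ ¬ e'.IsDiag then 1 else if (∃ y ∈ e', y ∈ S) then 0 else u e')).real
          (⋃ v ∈ N, openConn v b) := by
    by_cases hbN : b ∈ N
    · -- `b ∈ N`: the block reaches `b` surely
      have huniv : (⋃ v ∈ N, openConn v b : Set (BondConfig (Fin n))) = Set.univ := by
        refine Set.eq_univ_of_forall fun ω => Set.mem_iUnion₂.2 ⟨b, hbN, ?_⟩
        exact SimpleGraph.Reachable.refl _
      rw [huniv, probReal_univ]
      exact measureReal_le_one
    · exact stub_gluingLemma5 n (fun e' : Sym2 (Fin n) => if (∃ y ∈ e', y ∈ S) then (0 : unitInterval) else u e')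
        N e v b hvN hbN (hmin v hvA)
  linarith

/-- **Drop the relay layers.**  At a Question-9 designation `e` of the glued block `S` (`e ∈ A` minimising `μ_{q_∅}(· ↔ b)` over `A`,
`b ∈ A`, `Disjoint S A`):  `T_e^{u/S}(S) ≥ Σ_{N : Disjoint N A} μ_{u/S}(L_N) · T_e^{q_N}(N)`.
[cite: KozmaNitzan2024, §3.2 pp. 12–14 (proof of Thms 4–5), Question 9 (p. 36)] -/
theorem T_block_dropRelayLayers (u : Sym2 (Fin n) → unitInterval) (A S : Finset (Fin n)) (e b : Fin n)
    (hb : b ∈ A) (hSA : Disjoint S A) (he : e ∈ A)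
    (hmin : ∀ a ∈ A,
      (prodBernoulli (fun e' : Sym2 (Fin n) => if (∃ y ∈ e', y ∈ S) then (0 : unitInterval) else u e')).real (openConn e b) ≤
        (prodBernoulli (fun e' : Sym2 (Fin n) => if (∃ y ∈ e', y ∈ S) then (0 : unitInterval) else u e')).real (openConn a b)) :
    ∑ N ∈ (Finset.univ : Finset (Finset (Fin n))).filter (fun N => Disjoint N A),
        (prodBernoulli (fun e' : Sym2 (Fin n) => if (∀ y ∈ e', y ∈ S) ∧ ¬ e'.IsDiag then 1 else u e')).real
            {ω : BondConfig (Fin n) | ∀ y : Fin n, y ∈ N ↔ (y ∉ S ∧ ∃ o ∈ S, s(o, y) ∈ ω)} *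
          ((prodBernoulli (fun e' : Sym2 (Fin n) =>
                if (∀ y ∈ e', y ∈ N) ∧ ¬ e'.IsDiag then 1 else if (∃ y ∈ e', y ∈ S) then 0 else u e')).real
              (⋃ v ∈ N, ⋃ a ∈ A, openConn v a)ᶜ +
            (prodBernoulli (fun e' : Sym2 (Fin n) =>
                if (∀ y ∈ e', y ∈ N) ∧ ¬ e'.IsDiag then 1 else if (∃ y ∈ e', y ∈ S) then 0 else u e')).real
              (⋃ v ∈ N, openConn v b) -
            (prodBernoulli (fun e' : Sym2 (Fin n) =>
                if (∀ y ∈ e', y ∈ N) ∧ ¬ e'.IsDiag then 1 else if (∃ y ∈ e', y ∈ S) then 0 else u e')).real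
              (openConn e b)) ≤
      (prodBernoulli (fun e' : Sym2 (Fin n) => if (∀ y ∈ e', y ∈ S) ∧ ¬ e'.IsDiag then 1 else u e')).real
          (⋃ v ∈ S, ⋃ a ∈ A, openConn v a)ᶜ +
        (prodBernoulli (fun e' : Sym2 (Fin n) => if (∀ y ∈ e', y ∈ S) ∧ ¬ e'.IsDiag then 1 else u e')).real
          (⋃ v ∈ S, openConn v b) -
        (prodBernoulli (fun e' : Sym2 (Fin n) => if (∀ y ∈ e', y ∈ S) ∧ ¬ e'.IsDiag then 1 else u e')).real
          (openConn e b) := by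
  have heS : e ∉ S := fun h => Finset.disjoint_left.1 hSA h he
  rw [T_blockExpansion u A S e b hb hSA heS,
    ← Finset.sum_filter_add_sum_filter_not (Finset.univ : Finset (Finset (Fin n))) (fun N => Disjoint N A)]
  have hrest : 0 ≤ ∑ N ∈ (Finset.univ : Finset (Finset (Fin n))).filter (fun N => ¬ Disjoint N A),
        (prodBernoulli (fun e' : Sym2 (Fin n) => if (∀ y ∈ e', y ∈ S) ∧ ¬ e'.IsDiag then 1 else u e')).real
            {ω : BondConfig (Fin n) | ∀ y : Fin n, y ∈ N ↔ (y ∉ S ∧ ∃ o ∈ S, s(o, y) ∈ ω)} *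
          ((prodBernoulli (fun e' : Sym2 (Fin n) =>
                if (∀ y ∈ e', y ∈ N) ∧ ¬ e'.IsDiag then 1 else if (∃ y ∈ e', y ∈ S) then 0 else u e')).real
              (⋃ v ∈ N, ⋃ a ∈ A, openConn v a)ᶜ +
            (prodBernoulli (fun e' : Sym2 (Fin n) =>
                if (∀ y ∈ e', y ∈ N) ∧ ¬ e'.IsDiag then 1 else if (∃ y ∈ e', y ∈ S) then 0 else u e')).real
              (⋃ v ∈ N, openConn v b) -
            (prodBernoulli (fun e' : Sym2 (Fin n) =>
                if (∀ y ∈ e', y ∈ N) ∧ ¬ e'.IsDiag then 1 else if (∃ y ∈ e', y ∈ S) then 0 else u e')).real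
              (openConn e b)) := by
    refine Finset.sum_nonneg fun N hN => ?_
    have hNA : ¬ Disjoint N A := (Finset.mem_filter.1 hN).2
    exact mul_nonneg measureReal_nonneg (T_layer_relay_nonneg u A S N e b hmin hNA)
  linarith

/-- **The empty layer** (isolated corner of the T-form): its bracket is `1 − μ_{q_∅}(e ↔ b)`.
[cite: KozmaNitzan2024, §3.2 p. 14] -/
theorem T_layer_empty (u : Sym2 (Fin n) → unitInterval) (A S : Finset (Fin n)) (e b : Fin n) :
    (prodBernoulli (fun e' : Sym2 (Fin n) =>
            if (∀ y ∈ e', y ∈ (∅ : Finset (Fin n))) ∧ ¬ e'.IsDiag then 1 else if (∃ y ∈ e', y ∈ S) then 0 else u e')).real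
          (⋃ v ∈ (∅ : Finset (Fin n)), ⋃ a ∈ A, openConn v a)ᶜ +
        (prodBernoulli (fun e' : Sym2 (Fin n) =>
            if (∀ y ∈ e', y ∈ (∅ : Finset (Fin n))) ∧ ¬ e'.IsDiag then 1 else if (∃ y ∈ e', y ∈ S) then 0 else u e')).real
          (⋃ v ∈ (∅ : Finset (Fin n)), openConn v b) -
        (prodBernoulli (fun e' : Sym2 (Fin n) =>
            if (∀ y ∈ e', y ∈ (∅ : Finset (Fin n))) ∧ ¬ e'.IsDiag then 1 else if (∃ y ∈ e', y ∈ S) then 0 else u e')).real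
          (openConn e b) =
      1 - (prodBernoulli (fun e' : Sym2 (Fin n) => if (∃ y ∈ e', y ∈ S) then (0 : unitInterval) else u e')).real
          (openConn e b) := by
  rw [wbk_q_empty u S]
  simp only [Finset.notMem_empty, Set.iUnion_of_empty, Set.iUnion_empty, Set.compl_empty, probReal_univ,
    measureReal_empty]
  ring

/-- **One level of the V⁺ / V_{Q9} recursion (the block certificate).**  At a Question-9 designation `e` of the glued block `S`:
`T_e^{u/S}(S) ≥ μ_{u/S}(L_∅) · (1 − μ_{q_∅}(e ↔ b)) + Σ_{N ≠ ∅, Disjoint N A} μ_{u/S}(L_N) · T_e^{q_N}(N)`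
— relay layers dropped by gluing Lemma 5, the isolated corner kept exactly, the relay-free layers left as the T-functionals of the
glued layer blocks in the graph with `S` deleted (to which `T_blockExpansion` applies again).
[cite: KozmaNitzan2024, §3.2 pp. 12–14, Question 9 (p. 36)] -/
theorem T_block_certificate (u : Sym2 (Fin n) → unitInterval) (A S : Finset (Fin n)) (e b : Fin n)
    (hb : b ∈ A) (hSA : Disjoint S A) (he : e ∈ A)
    (hmin : ∀ a ∈ A,
      (prodBernoulli (fun e' : Sym2 (Fin n) => if (∃ y ∈ e', y ∈ S) then (0 : unitInterval) else u e')).real (openConn e b) ≤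
        (prodBernoulli (fun e' : Sym2 (Fin n) => if (∃ y ∈ e', y ∈ S) then (0 : unitInterval) else u e')).real (openConn a b)) :
    (prodBernoulli (fun e' : Sym2 (Fin n) => if (∀ y ∈ e', y ∈ S) ∧ ¬ e'.IsDiag then 1 else u e')).real
          {ω : BondConfig (Fin n) | ∀ y : Fin n, y ∈ (∅ : Finset (Fin n)) ↔ (y ∉ S ∧ ∃ o ∈ S, s(o, y) ∈ ω)} *
        (1 - (prodBernoulli (fun e' : Sym2 (Fin n) => if (∃ y ∈ e', y ∈ S) then (0 : unitInterval) else u e')).real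
          (openConn e b)) +
      ∑ N ∈ (Finset.univ : Finset (Finset (Fin n))).filter (fun N => N.Nonempty ∧ Disjoint N A),
        (prodBernoulli (fun e' : Sym2 (Fin n) => if (∀ y ∈ e', y ∈ S) ∧ ¬ e'.IsDiag then 1 else u e')).real
            {ω : BondConfig (Fin n) | ∀ y : Fin n, y ∈ N ↔ (y ∉ S ∧ ∃ o ∈ S, s(o, y) ∈ ω)} *
          ((prodBernoulli (fun e' : Sym2 (Fin n) =>
                if (∀ y ∈ e', y ∈ N) ∧ ¬ e'.IsDiag then 1 else if (∃ y ∈ e', y ∈ S) then 0 else u e')).real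
              (⋃ v ∈ N, ⋃ a ∈ A, openConn v a)ᶜ +
            (prodBernoulli (fun e' : Sym2 (Fin n) =>
                if (∀ y ∈ e', y ∈ N) ∧ ¬ e'.IsDiag then 1 else if (∃ y ∈ e', y ∈ S) then 0 else u e')).real
              (⋃ v ∈ N, openConn v b) -
            (prodBernoulli (fun e' : Sym2 (Fin n) =>
                if (∀ y ∈ e', y ∈ N) ∧ ¬ e'.IsDiag then 1 else if (∃ y ∈ e', y ∈ S) then 0 else u e')).real
              (openConn e b)) ≤
      (prodBernoulli (fun e' : Sym2 (Fin n) => if (∀ y ∈ e', y ∈ S) ∧ ¬ e'.IsDiag then 1 else u e')).real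
          (⋃ v ∈ S, ⋃ a ∈ A, openConn v a)ᶜ +
        (prodBernoulli (fun e' : Sym2 (Fin n) => if (∀ y ∈ e', y ∈ S) ∧ ¬ e'.IsDiag then 1 else u e')).real
          (⋃ v ∈ S, openConn v b) -
        (prodBernoulli (fun e' : Sym2 (Fin n) => if (∀ y ∈ e', y ∈ S) ∧ ¬ e'.IsDiag then 1 else u e')).real
          (openConn e b) := by
  have h := T_block_dropRelayLayers u A S e b hb hSA he hmin
  -- split the sum over `Disjoint N A` into `N = ∅` and `N ≠ ∅`
  have hsplit : (Finset.univ : Finset (Finset (Fin n))).filter (fun N => Disjoint N A) =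
      insert ∅ ((Finset.univ : Finset (Finset (Fin n))).filter (fun N => N.Nonempty ∧ Disjoint N A)) := by
    ext N
    simp only [Finset.mem_filter, Finset.mem_univ, true_and, Finset.mem_insert]
    constructor
    · intro hN
      rcases N.eq_empty_or_nonempty with h1 | h1
      · exact Or.inl h1
      · exact Or.inr ⟨h1, hN⟩
    · rintro (rfl | ⟨-, hN⟩)
      · exact Finset.disjoint_empty_left A
      · exact hN
  have hnot : (∅ : Finset (Fin n)) ∉ (Finset.univ : Finset (Finset (Fin n))).filter (fun N => N.Nonempty ∧ Disjoint N A) := by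
    simp
  rw [hsplit, Finset.sum_insert hnot, T_layer_empty u A S e b] at h
  exact h

/-- Registered rung `stub_TblockCertificate_vp` of crux stmt-CriticalPhenomena-4576 (depth prover png-dp-vplus, seat (b) V⁺-form): one level
of the V⁺ recursion for a glued block at its Question-9 designation — `T_block_certificate`, closed statement.
[cite: KozmaNitzan2024, §3.2 pp. 12–14, Question 9 (p. 36)] -/
theorem stub_TblockCertificate_vp : ∀ (n : ℕ) (u : Sym2 (Fin n) → unitInterval) (A S : Finset (Fin n)) (e b : Fin n), b ∈ A → Disjoint S A → e ∈ A → (∀ a ∈ A, (Literature.Probability.LatticeModels.prodBernoulli (fun e' : Sym2 (Fin n) => if (∃ y ∈ e', y ∈ S) then (0 : unitInterval) else u e')).real (Literature.Probability.Percolation.openConn e b) ≤ (Literature.Probability.LatticeModels.prodBernoulli (fun e' : Sym2 (Fin n) => if (∃ y ∈ e', y ∈ S) then (0 : unitInterval) else u e')).real (Literature.Probability.Percolation.openConn a b)) → (Literature.Probability.LatticeModels.prodBernoulli (fun e' : Sym2 (Fin n) => if (∀ y ∈ e', y ∈ S) ∧ ¬ e'.IsDiag then 1 else u e')).real {ω :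 Literature.Probability.Percolation.BondConfig (Fin n) | ∀ y : Fin n, y ∈ (∅ : Finset (Fin n)) ↔ (y ∉ S ∧ ∃ o ∈ S, s(o, y) ∈ ω)} * (1 - (Literature.Probability.LatticeModels.prodBernoulli (fun e' : Sym2 (Fin n) => if (∃ y ∈ e', y ∈ S) then (0 : unitInterval) else u e')).real (Literature.Probability.Percolation.openConn e b)) + ∑ N ∈ (Finset.univ : Finset (Finset (Fin n))).filter (fun N => N.Nonempty ∧ Disjoint N A), (Literature.Probability.LatticeModels.prodBernoulli (fun e' : Sym2 (Fin n) => if (∀ y ∈ e', y ∈ S) ∧ ¬ e'.IsDiag then 1 else u e')).real {ω : Literature.Probability.Percolation.BondConfig (Fin n) | ∀ y : Fin n, y ∈ N ↔ (y ∉ S ∧ ∃ o ∈ S, s(o, y) ∈ ω)} * ((Literature.Probability.LatticeModels.prodBernoulli (fun e' : Sym2 (Fin n) => if (∀ y ∈ e', y ∈ N) ∧ ¬ e'.IsDiag then 1 else if (∃ y ∈ e', y ∈ S) then 0 else u e')).real (⋃ v ∈ N, ⋃ a ∈ A, Literature.Probability.Percolation.openConn v a)ᶜ + (Literature.Probability.LatticeModels.prodBernoulli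 (fun e' : Sym2 (Fin n) => if (∀ y ∈ e', y ∈ N) ∧ ¬ e'.IsDiag then 1 else if (∃ y ∈ e', y ∈ S) then 0 else u e')).real (⋃ v ∈ N, Literature.Probability.Percolation.openConn v b) - (Literature.Probability.LatticeModels.prodBernoulli (fun e' : Sym2 (Fin n) => if (∀ y ∈ e', y ∈ N) ∧ ¬ e'.IsDiag then 1 else if (∃ y ∈ e', y ∈ S) then 0 else u e')).real (Literature.Probability.Percolation.openConn e b)) ≤ (Literature.Probability.LatticeModels.prodBernoulli (fun e' : Sym2 (Fin n) => if (∀ y ∈ e', y ∈ S) ∧ ¬ e'.IsDiag then 1 else u e')).real (⋃ v ∈ S, ⋃ a ∈ A, Literature.Probability.Percolation.openConn v a)ᶜ + (Literature.Probability.LatticeModels.prodBernoulli (fun e' : Sym2 (Fin n) => if (∀ y ∈ e', y ∈ S) ∧ ¬ e'.IsDiag then 1 else u e')).real (⋃ v ∈ S, Literature.Probability.Percolation.openConn v b) - (Literature.Probability.LatticeModels.prodBernoulli (fun e' : Sym2 (Fin n) => if (∀ y ∈ e', y ∈ S) ∧ ¬ e'.IsDiag then 1 else u e')).real (Literature.Probability.Percolation.openConn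 e b) :=
  fun _ u A S e b hb hSA he hmin => T_block_certificate u A S e b hb hSA he hmin

end TBlockCertificate

end

end Summit.CriticalPhenomena.PercolationContinuityZ3.Theorems
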